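import Literature.Computability.AlgebraicComplexity.TypeRestrictionConcentration
import HarnessLib

/-!
# Concentration of pair statistics of random words of a type class
(Vassilevska Williams–Xu–Xu–Zhou 2024, §6.6, first type of holes: "the fraction of
`(î_{2^{ℓ−2}+1}, …, î_{2^{ℓ−1}})` in the even positions … is `β ± o(1)` … Applying concentration bounds again")
— proved

Topic `Literature/Computability/AlgebraicComplexity`.  In §6.6 of Vassilevska Williams–Xu–Xu–Zhou,
*New bounds for matrix multiplication: from alpha to omega* (SODA 2024, arXiv:2307.07970), a
uniformly random level-1 `X`-block of `𝒯*` — on each position class an independent uniformly random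
word with prescribed letter counts — is shown to have, in every group of level-`ℓ` chunks of one split
type `(i',j',k')`, an empirical distribution of (left half-chunk, right half-chunk) PAIRS close to the
product `β_{X,t,i',j',k'} × β_{X,t,i_t−i',j_t−j',k_t−k'}`: "the fraction of `(î₁,…,î_{2^{ℓ−2}})` among
the odd positions … is `β ± o(1)` with `1 − 1/poly(n)` probability, by concentration bounds.
Furthermore, the subset of positions … is also random. Similarly … the even positions … Applying
concentration bounds again …".  This file PROVES the two counting statements behind this, from the
single-set bound of `TypeRestrictionConcentration.lean` by transport and conditioning:

* `countOn`, `typeClassOn_restriction_concentration` — the single-set bound on an arbitrary finite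
  position type (transport along `X ≃ Fin |X|`);
* `card_typeClassOn_filter_restrict_eq`, `card_typeClassOn_eq_sum_restrict` — **conditioning**: the
  words of type `k` extending a pattern `v` on `P₁` correspond bijectively to the words on `P₁ᶜ` of type
  `k − count(v)` ("the subset of positions … is also random");
* `pairCount`, `twoWord_pairCount_concentration` — **two independent words** (a split type
  `(i',j',k') ≠ (i_t−i',…)`, left halves in one class and right halves in another): the pairs
  `(w₁, w₂) ∈ T(C₁,k₁) × T(C₂,k₂)` with some pair count off by `≥ ε m` from
  `m (k₁(a)/|C₁|)(k₂(b)/|C₂|)` are at most `(m+1)^{|A|}((|C₁|+1)^{|A|} + |A|²(|C₂|+1)^{|A|}) e^{−mε²/8} |T₁||T₂|`;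
* `oneWord_pattern_pair_bound`, `oneWord_pairCount_concentration` — **one word, self-paired class**
  (`(i',j',k') = (i_t−i',…)`, left and right halves in the same class, disjoint probe positions): at
  most `(1+|A|²)(m+1)^{|A|}(|C|+1)^{|A|} e^{−mε²/32} |T(C,k)|` words have a pair count off by `≥ ε m`.

Everything is proved; the definitions are `countOn`, `patternCount`, `pairCount`; no named facts.

## References

* V. Vassilevska Williams, Y. Xu, Z. Xu, R. Zhou, *New bounds for matrix multiplication: from alpha
  to omega*, SODA 2024, arXiv:2307.07970 (held: `paper:arxiv-2307.07970`), §6.6. [VassilevskaWilliamsXuXuZhou2024]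
* T. M. Cover, J. A. Thomas, *Elements of Information Theory*, 2nd ed., Wiley 2006, §11.1.
  [CoverThomas2006]
-/

noncomputable section

open scoped BigOperators
open Finset Real

namespace Literature.Computability.AlgebraicComplexity

/-! ## Counts on a set of positions of an arbitrary position type -/

section CountOn

variable {A : Type*} [DecidableEq A] {X : Type*}

/-- The letter counts of a word `v : X → A` on a finite set `P` of positions. [folklore] -/
def countOn (P : Finset X) (v : X → A) (a : A) : ℕ := (P.filter fun x => v x = a).card

/-- Unfolding. [folklore] -/
theorem countOn_apply (P : Finset X) (v : X → A) (a : A) : countOn P v a = (P.filter fun x => v x = a).card := rfl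

/-- On `Fin M` this is `letterCountOn`. [folklore] -/
theorem letterCountOn_eq_countOn {M : ℕ} (P : Finset (Fin M)) (w : Fin M → A) : letterCountOn P w = countOn P w := rfl

/-- `∑_a countOn = |P|`. [folklore] -/
theorem sum_countOn [Fintype A] (P : Finset X) (v : X → A) : ∑ a, countOn P v a = P.card := by
  unfold countOn
  exact (card_eq_sum_card_fiberwise (f := v) (s := P) (t := univ) fun _ _ => mem_univ _).symm

/-- `countOn ≤ |P|`. [folklore] -/
theorem countOn_le_card (P : Finset X) (v : X → A) (a : A) : countOn P v a ≤ P.card := card_filter_le _ _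

/-- Counts are invariant under transporting positions along an equivalence. [folklore] -/
theorem countOn_map_equiv {Y : Type*} (e : X ≃ Y) (P : Finset X) (v : X → A) (a : A) :
    countOn (P.map e.toEmbedding) (v ∘ e.symm) a = countOn P v a := by
  rw [countOn_apply, countOn_apply, filter_map, card_map]
  congr 1
  ext x
  simp

/-- Counts on all positions of a member of `typeClassOn`. [folklore] -/
theorem countOn_univ_of_mem_typeClassOn [Fintype A] [Fintype X] [DecidableEq X] {k : A → ℕ} {v : X → A}
    (hv : v ∈ typeClassOn X k) (a : A) : countOn univ v a = k a :=
  (mem_typeClassOn.1 hv) a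

/-- Counts on `P` are at most counts on all positions. [folklore] -/
theorem countOn_le_countOn_univ [Fintype X] (P : Finset X) (v : X → A) (a : A) : countOn P v a ≤ countOn univ v a :=
  card_le_card (filter_subset_filter _ (subset_univ P))

end CountOn

/-! ## Transport of the single-set concentration bound to an arbitrary position type -/

section Transport

variable {A : Type*} [Fintype A] [DecidableEq A] {X : Type*} [Fintype X] [DecidableEq X]

/-- Transport of type classes along `X ≃ Fin |X|`. [folklore] -/
theorem comp_symm_mem_typeClass_iff (e : X ≃ Fin (Fintype.card X)) (k : A → ℕ) (v : X → A) :
    v ∘ e.symm ∈ typeClass (Fintype.card X) k ↔ v ∈ typeClassOn X k := by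
  rw [mem_typeClass, mem_typeClassOn, funext_iff]
  refine forall_congr' fun a => ?_
  rw [letterCount_apply]
  have : (univ.filter fun m => (v ∘ e.symm) m = a) = (univ.filter fun x => v x = a).map e.toEmbedding := by
    ext i; simp
  rw [this, card_map]

/-- **The single-set concentration bound on an arbitrary finite position type** (transport of
`typeClass_restriction_concentration` along `X ≃ Fin |X|`). [cite: CoverThomas2006, Thm. 11.1.4 and Lemma 11.6.1] -/
theorem typeClassOn_restriction_concentration (k : A → ℕ) (hk : ∑ a, k a = Fintype.card X) (P : Finset X) {δ : ℝ}
    (hδ : 0 < δ) :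
    (((typeClassOn X k).filter fun v => ∃ a, δ ≤ |(countOn P v a : ℝ) / P.card - (k a : ℝ) / Fintype.card X|).card : ℝ) ≤
      ((P.card : ℝ) + 1) ^ Fintype.card A * ((Fintype.card X : ℝ) + 1) ^ Fintype.card A *
        Real.exp (-(P.card * δ ^ 2 / 2)) * (typeClassOn X k).card := by
  classical
  set M := Fintype.card X with hM
  set e : X ≃ Fin M := Fintype.equivFin X
  have hmain := typeClass_restriction_concentration k hk (P.map e.toEmbedding) hδ
  rw [card_map] at hmain
  -- the bad sets and the type classes correspond under `v ↦ v ∘ e.symm`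
  have hbad : ((typeClassOn X k).filter fun v => ∃ a, δ ≤ |(countOn P v a : ℝ) / P.card - (k a : ℝ) / M|).card =
      ((typeClass M k).filter fun w => ∃ a, δ ≤ |(letterCountOn (P.map e.toEmbedding) w a : ℝ) / P.card - (k a : ℝ) / M|).card := by
    refine card_bij (fun v _ => v ∘ e.symm) (fun v hv => ?_) (fun v₁ _ v₂ _ h => ?_) (fun w hw => ?_)
    · rw [mem_filter] at hv ⊢
      refine ⟨(comp_symm_mem_typeClass_iff e k v).2 hv.1, ?_⟩
      obtain ⟨a, ha⟩ := hv.2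
      refine ⟨a, ?_⟩
      rw [letterCountOn_eq_countOn, countOn_map_equiv]; exact ha
    · funext x; have := congrFun h (e x); simpa using this
    · rw [mem_filter] at hw
      refine ⟨w ∘ e, mem_filter.2 ⟨?_, ?_⟩, by funext i; simp⟩
      · rw [← comp_symm_mem_typeClass_iff e k]
        have : (w ∘ ⇑e) ∘ ⇑e.symm = w := by funext i; simp
        rw [this]; exact hw.1
      · obtain ⟨a, ha⟩ := hw.2
        refine ⟨a, ?_⟩
        have h2 := countOn_map_equiv e P (w ∘ e) a
        have : (w ∘ ⇑e) ∘ ⇑e.symm = w := by funext i; simp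
        rw [this] at h2
        rw [← h2, ← letterCountOn_eq_countOn]; exact ha
  have hT : (typeClassOn X k).card = (typeClass M k).card := by
    rw [card_typeClassOn_eq_multinomial k hk, card_typeClass_eq_multinomial M k hk]
  rw [hbad, hT]
  exact hmain

end Transport

/-! ## Conditioning on the pattern on a set of positions -/

section Conditioning

variable {A : Type*} [Fintype A] [DecidableEq A] {C : Type*} [Fintype C] [DecidableEq C]

/-- The letter counts of a pattern `v` on the positions `P₁` (as a function on the subtype). [folklore] -/
abbrev patternCount (P₁ : Finset C) (v : ↥P₁ → A) (a : A) : ℕ := (univ.filter fun p : ↥P₁ => v p = a).card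

omit [Fintype A] [Fintype C] [DecidableEq C] in
/-- Counts on `Q` as counts of the restricted pattern. [folklore] -/
theorem countOn_eq_card_subtype (w : C → A) (Q : Finset C) (a : A) :
    countOn Q w a = (univ.filter fun p : ↥Q => w p = a).card := by
  rw [countOn_apply]
  refine card_bij (fun p hp => ⟨p, (mem_filter.1 hp).1⟩) (fun p hp => by simpa using (mem_filter.1 hp).2)
    (fun p₁ _ p₂ _ h => by simpa using h) (fun p hp => ⟨p.1, mem_filter.2 ⟨p.2, by simpa using hp⟩, rfl⟩)

omit [Fintype A] [Fintype C] [DecidableEq C] in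
/-- Counts on `P₁` of a word extending the pattern `v` are the pattern counts. [folklore] -/
theorem countOn_eq_patternCount_of_restrict {P₁ : Finset C} {w : C → A} {v : ↥P₁ → A} (hwv : ∀ p : ↥P₁, w p = v p) (a : A) :
    countOn P₁ w a = patternCount P₁ v a := by
  rw [countOn_eq_card_subtype]; congr 1; ext p; simp [hwv p]

/-- **Conditioning bijection**: the words of type `k` extending a pattern `v` on `P₁` are in bijection,
by restriction to `P₁ᶜ`, with the words on `P₁ᶜ` of type `k − count(v)` (when `count(v) ≤ k`).
[cite: CoverThomas2006, §11.1 (type classes)] -/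
theorem card_typeClassOn_filter_restrict_eq (k : A → ℕ) (P₁ : Finset C) (v : ↥P₁ → A) (hv : ∀ a, patternCount P₁ v a ≤ k a) :
    ((typeClassOn C k).filter fun w => ∀ p : ↥P₁, w p = v p).card =
      (typeClassOn ↥(P₁ᶜ) fun a => k a - patternCount P₁ v a).card := by
  classical
  -- counts split over `P₁` and `P₁ᶜ`
  have hsplit : ∀ (w : C → A) (a : A), countOn univ w a = countOn P₁ w a + countOn P₁ᶜ w a := by
    intro w a
    rw [countOn_apply, countOn_apply, countOn_apply, ← card_union_of_disjoint]
    · congr 1; ext p; simp only [mem_filter, mem_univ, true_and, mem_union, mem_compl]; tauto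
    · exact disjoint_filter_filter (disjoint_compl_right)
  have hsub : ∀ (w : C → A) (Q : Finset C) (a : A), countOn Q w a = (univ.filter fun p : ↥Q => w p = a).card := by
    intro w Q a
    rw [countOn_apply]
    refine card_bij (fun p hp => ⟨p, (mem_filter.1 hp).1⟩) (fun p hp => by simpa using (mem_filter.1 hp).2)
      (fun p₁ _ p₂ _ h => by simpa using h) (fun p hp => ⟨p.1, mem_filter.2 ⟨p.2, by simpa using hp⟩, rfl⟩)
  refine card_bij (fun w _ => fun p : ↥(P₁ᶜ) => w p) (fun w hw => ?_) (fun w₁ hw₁ w₂ hw₂ h => ?_) (fun u hu => ?_)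
  · -- restriction lands in the right type class
    rw [mem_filter] at hw
    obtain ⟨hwk, hwv⟩ := hw
    refine mem_typeClassOn.2 fun a => ?_
    have h1 : countOn P₁ w a = patternCount P₁ v a := by
      rw [hsub]; congr 1; ext p; simp [hwv p]
    have h2 := hsplit w a
    rw [countOn_univ_of_mem_typeClassOn hwk, h1] at h2
    rw [← hsub w P₁ᶜ a]; omega
  · -- injective: determined by `v` on `P₁` and by the restriction elsewhere
    rw [mem_filter] at hw₁ hw₂
    funext p
    by_cases hp : p ∈ P₁
    · rw [hw₁.2 ⟨p, hp⟩, hw₂.2 ⟨p, hp⟩]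
    · exact congrFun h ⟨p, mem_compl.2 hp⟩
  · -- surjective: glue `v` and `u`
    refine ⟨fun p => if hp : p ∈ P₁ then v ⟨p, hp⟩ else u ⟨p, mem_compl.2 hp⟩, mem_filter.2 ⟨?_, fun p => by simp [p.2]⟩, ?_⟩
    · refine mem_typeClassOn.2 fun a => ?_
      set w : C → A := fun p => if hp : p ∈ P₁ then v ⟨p, hp⟩ else u ⟨p, mem_compl.2 hp⟩ with hwdef
      have h1 : countOn P₁ w a = patternCount P₁ v a := by
        rw [hsub]; congr 1; ext p; simp [hwdef]
      have h3 : countOn P₁ᶜ w a = k a - patternCount P₁ v a := by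
        rw [hsub, ← (mem_typeClassOn.1 hu) a]; congr 1; ext p
        have hp : (p : C) ∉ P₁ := mem_compl.1 p.2
        simp [hwdef, hp]
      have h2 := hsplit w a
      rw [h1, h3] at h2
      change countOn univ w a = k a
      have := hv a; omega
    · funext p
      have hp : (p : C) ∉ P₁ := mem_compl.1 p.2
      simp [hp]

/-- Fibrewise decomposition over the patterns on `P₁`: `|T(C,k)| = ∑_v #{w ∈ T(C,k) | w|_{P₁} = v}`. [folklore] -/
theorem card_typeClassOn_eq_sum_restrict (k : A → ℕ) (P₁ : Finset C) :
    (typeClassOn C k).card = ∑ v : ↥P₁ → A, ((typeClassOn C k).filter fun w => ∀ p : ↥P₁, w p = v p).card := by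
  classical
  rw [card_eq_sum_card_fiberwise (f := fun (w : C → A) (p : ↥P₁) => w p) (s := typeClassOn C k) (t := univ)
    fun _ _ => mem_univ _]
  refine sum_congr rfl fun v _ => ?_
  congr 1; ext w; simp [funext_iff]

end Conditioning

/-! ## Pair statistics of two independent random words -/

section TwoWords

variable {A : Type*} [Fintype A] [DecidableEq A]
variable {C₁ C₂ U : Type*} [Fintype C₁] [DecidableEq C₁] [Fintype C₂] [DecidableEq C₂] [Fintype U]

/-- **Pair counts**: the number of probes `u` at which the first word shows `a` (at position `ℓ u`) and
the second shows `b` (at position `r u`) — the empirical pair distribution of (left half, right half)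
over the chunks of one split type. [cite: VassilevskaWilliamsXuXuZhou2024, §6.6 (first type of holes)] -/
def pairCount (ℓ : U → C₁) (r : U → C₂) (w₁ : C₁ → A) (w₂ : C₂ → A) (ab : A × A) : ℕ :=
  (univ.filter fun u => w₁ (ℓ u) = ab.1 ∧ w₂ (r u) = ab.2).card

omit [Fintype A] [Fintype C₁] [DecidableEq C₁] [Fintype C₂] [DecidableEq C₂] in
/-- A pair count is a count of the second word on the `r`-image of the `a`-probes of the first word.
[folklore] -/
theorem pairCount_eq_countOn (ℓ : U → C₁) (r : U ↪ C₂) (w₁ : C₁ → A) (w₂ : C₂ → A) (ab : A × A) :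
    pairCount ℓ r w₁ w₂ ab = countOn ((univ.filter fun u => w₁ (ℓ u) = ab.1).map r) w₂ ab.2 := by
  rw [pairCount, countOn_apply, filter_map, card_map, filter_filter]
  rfl

omit [Fintype A] [Fintype C₁] [DecidableEq C₁] in
/-- The number of `a`-probes of the first word is a count on the `ℓ`-image. [folklore] -/
theorem card_filter_probe_eq_countOn (ℓ : U ↪ C₁) (w₁ : C₁ → A) (a : A) :
    (univ.filter fun u => w₁ (ℓ u) = a).card = countOn (univ.map ℓ) w₁ a := by
  rw [countOn_apply, filter_map, card_map]
  rfl

/-- **Concentration of pair statistics for two independent uniformly random words of type classes.**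
For types `k₁` on `C₁`, `k₂` on `C₂`, injective probes `ℓ : U ↪ C₁`, `r : U ↪ C₂` (`m = |U| ≥ 1`) and
`ε > 0`, the number of pairs `(w₁, w₂) ∈ T(C₁,k₁) × T(C₂,k₂)` with SOME pair count deviating from the
product prediction by `≥ ε m`, `|#{u | w₁(ℓu) = a, w₂(ru) = b} − m (k₁(a)/|C₁|)(k₂(b)/|C₂|)| ≥ ε m`, is at most
`(m+1)^{|A|} ((|C₁|+1)^{|A|} + |A|² (|C₂|+1)^{|A|}) e^{−m ε²/8} |T(C₁,k₁)| |T(C₂,k₂)|`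
(first word typical on `ℓ(U)` except for an exponentially small fraction; given a typical first word,
each pair count is a count of the second word on a fixed set of `≈ m k₁(a)/|C₁|` positions).
[cite: VassilevskaWilliamsXuXuZhou2024, §6.6 ("the fraction … in the even positions … is β ± o(1) … Applying concentration bounds again"); CoverThomas2006, Thm. 11.1.4] -/
theorem twoWord_pairCount_concentration (k₁ k₂ : A → ℕ) (hk₁ : ∑ a, k₁ a = Fintype.card C₁) (hk₂ : ∑ a, k₂ a = Fintype.card C₂)
    (ℓ : U ↪ C₁) (r : U ↪ C₂) (hU : 0 < Fintype.card U) {ε : ℝ} (hε : 0 < ε) :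
    ((((typeClassOn C₁ k₁) ×ˢ (typeClassOn C₂ k₂)).filter fun w => ∃ ab : A × A,
        ε * Fintype.card U ≤ |(pairCount ℓ r w.1 w.2 ab : ℝ) -
          Fintype.card U * ((k₁ ab.1 : ℝ) / Fintype.card C₁) * ((k₂ ab.2 : ℝ) / Fintype.card C₂)|).card : ℝ) ≤
      ((Fintype.card U : ℝ) + 1) ^ Fintype.card A *
        (((Fintype.card C₁ : ℝ) + 1) ^ Fintype.card A + (Fintype.card A : ℝ) ^ 2 * ((Fintype.card C₂ : ℝ) + 1) ^ Fintype.card A) *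
        Real.exp (-(Fintype.card U * ε ^ 2 / 8)) * (typeClassOn C₁ k₁).card * (typeClassOn C₂ k₂).card := by
  classical
  set m := Fintype.card U with hmdef
  set M₁ := Fintype.card C₁ with hM₁
  set M₂ := Fintype.card C₂ with hM₂
  set T₁ := typeClassOn C₁ k₁ with hT₁
  set T₂ := typeClassOn C₂ k₂ with hT₂
  set δ : ℝ := ε / 2 with hδdef
  have hδ : 0 < δ := by rw [hδdef]; positivity
  have hmR : (0 : ℝ) < m := by exact_mod_cast hU
  set BadP : (C₁ → A) × (C₂ → A) → Prop := fun w => ∃ ab : A × A,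
      ε * m ≤ |(pairCount ℓ r w.1 w.2 ab : ℝ) - m * ((k₁ ab.1 : ℝ) / M₁) * ((k₂ ab.2 : ℝ) / M₂)| with hBadP
  set Bad := (T₁ ×ˢ T₂).filter BadP with hBad
  -- the typical first words on `ℓ(U)`
  set Far₁ := T₁.filter fun w₁ => ∃ a, δ ≤ |(countOn (univ.map ℓ) w₁ a : ℝ) / m - (k₁ a : ℝ) / M₁| with hFar₁
  have hmapcard : (univ.map ℓ).card = m := by rw [card_map, card_univ]
  have hFar₁_bound : (Far₁.card : ℝ) ≤ ((m : ℝ) + 1) ^ Fintype.card A * ((M₁ : ℝ) + 1) ^ Fintype.card A *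
      Real.exp (-(m * δ ^ 2 / 2)) * T₁.card := by
    have h := typeClassOn_restriction_concentration k₁ hk₁ (univ.map ℓ) hδ
    rw [hmapcard] at h
    exact h
  -- per typical first word and per pair: the second word is atypical on a fixed set of positions
  have hp₂le : ∀ b, (k₂ b : ℝ) / M₂ ≤ 1 := by
    intro b
    rcases Nat.eq_zero_or_pos M₂ with h0 | hpos
    · rw [h0]; simp
    · rw [div_le_one (by exact_mod_cast hpos)]
      have : k₂ b ≤ M₂ := by rw [← hk₂]; exact single_le_sum (fun _ _ => Nat.zero_le _) (mem_univ b)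
      exact_mod_cast this
  have hp₂nn : ∀ b, (0 : ℝ) ≤ (k₂ b : ℝ) / M₂ := fun b => by positivity
  have hfibre : ∀ w₁ ∈ T₁, w₁ ∉ Far₁ →
      ((T₂.filter fun w₂ => BadP (w₁, w₂)).card : ℝ) ≤
        (Fintype.card A : ℝ) ^ 2 * (((m : ℝ) + 1) ^ Fintype.card A * ((M₂ : ℝ) + 1) ^ Fintype.card A *
          Real.exp (-(m * ε ^ 2 / 8)) * T₂.card) := by
    intro w₁ hw₁ hgood
    -- `w₁` is `δ`-typical: every probe count is within `δ m`
    have htyp : ∀ a, |(countOn (univ.map ℓ) w₁ a : ℝ) / m - (k₁ a : ℝ) / M₁| < δ := by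
      intro a
      by_contra hge
      rw [not_lt] at hge
      exact hgood (mem_filter.2 ⟨hw₁, a, hge⟩)
    -- the bad set is covered by the `|A|²` per-pair bad sets
    have hcover : (T₂.filter fun w₂ => BadP (w₁, w₂)) ⊆
        (univ : Finset (A × A)).biUnion fun ab => T₂.filter fun w₂ =>
          ε * m ≤ |(pairCount ℓ r w₁ w₂ ab : ℝ) - m * ((k₁ ab.1 : ℝ) / M₁) * ((k₂ ab.2 : ℝ) / M₂)| := by
      intro w₂ hw₂
      rw [mem_filter] at hw₂
      obtain ⟨hT, ab, hab⟩ := hw₂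
      exact mem_biUnion.2 ⟨ab, mem_univ _, mem_filter.2 ⟨hT, hab⟩⟩
    have hper : ∀ ab : A × A, ((T₂.filter fun w₂ =>
        ε * m ≤ |(pairCount ℓ r w₁ w₂ ab : ℝ) - m * ((k₁ ab.1 : ℝ) / M₁) * ((k₂ ab.2 : ℝ) / M₂)|).card : ℝ) ≤
        ((m : ℝ) + 1) ^ Fintype.card A * ((M₂ : ℝ) + 1) ^ Fintype.card A * Real.exp (-(m * ε ^ 2 / 8)) * T₂.card := by
      intro ab
      obtain ⟨a, b⟩ := ab
      set Ua := univ.filter fun u => w₁ (ℓ u) = a with hUa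
      set P := Ua.map r with hP
      have hPcard : P.card = Ua.card := card_map _
      have hma_le : Ua.card ≤ m := (card_filter_le _ _).trans_eq (card_univ)
      have hmaR : (Ua.card : ℝ) ≤ m := by exact_mod_cast hma_le
      have hUa_count : (Ua.card : ℝ) = countOn (univ.map ℓ) w₁ a := by
        rw [hUa, card_filter_probe_eq_countOn]
      -- typicality of `a`: `|m_a - m p₁(a)| < δ m`
      have hma_typ : |(Ua.card : ℝ) - m * ((k₁ a : ℝ) / M₁)| < δ * m := by
        have h := htyp a
        rw [← hUa_count] at h
        have e : (Ua.card : ℝ) - m * ((k₁ a : ℝ) / M₁) = m * ((Ua.card : ℝ) / m - (k₁ a : ℝ) / M₁) := by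
          field_simp
        rw [e, abs_mul, abs_of_pos hmR]
        calc (m : ℝ) * |(Ua.card : ℝ) / m - (k₁ a : ℝ) / M₁| < m * δ := mul_lt_mul_of_pos_left h hmR
          _ = δ * m := mul_comm _ _
      rcases Nat.eq_zero_or_pos Ua.card with hma0 | hma_pos
      · -- no `a`-probes: the pair count vanishes and the prediction is within `δ m < ε m`
        have hset : (T₂.filter fun w₂ => ε * m ≤ |(pairCount ℓ r w₁ w₂ (a, b) : ℝ) - m * ((k₁ a : ℝ) / M₁) * ((k₂ b : ℝ) / M₂)|) = ∅ := by
          refine filter_false_of_mem fun w₂ _ => ?_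
          rw [not_le]
          have hle_pc : pairCount ℓ r w₁ w₂ (a, b) ≤ Ua.card := by
            rw [hUa]; unfold pairCount
            exact card_le_card fun u hu => by
              rw [mem_filter] at hu ⊢; exact ⟨hu.1, hu.2.1⟩
          have hpc : pairCount ℓ r w₁ w₂ (a, b) = 0 := by omega
          rw [hpc, Nat.cast_zero, zero_sub, abs_neg]
          rw [hma0, Nat.cast_zero, zero_sub, abs_neg] at hma_typ
          calc |(m : ℝ) * ((k₁ a : ℝ) / M₁) * ((k₂ b : ℝ) / M₂)| = |(m : ℝ) * ((k₁ a : ℝ) / M₁)| * ((k₂ b : ℝ) / M₂) := by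
                rw [abs_mul, abs_of_nonneg (hp₂nn b)]
            _ ≤ |(m : ℝ) * ((k₁ a : ℝ) / M₁)| * 1 := mul_le_mul_of_nonneg_left (hp₂le b) (abs_nonneg _)
            _ < δ * m := by rw [mul_one]; exact hma_typ
            _ ≤ ε * m := by rw [hδdef]; nlinarith
        rw [hset, card_empty, Nat.cast_zero]; positivity
      · -- `m_a ≥ 1`: a bad pair count makes `w₂` atypical on `P = r(U_a)` with deviation `(ε/2) m / m_a`
        have hmaR' : (0 : ℝ) < Ua.card := by exact_mod_cast hma_pos
        set δa : ℝ := (ε / 2) * (m / Ua.card) with hδa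
        have hδa_pos : 0 < δa := by rw [hδa]; positivity
        have hsub : (T₂.filter fun w₂ => ε * m ≤ |(pairCount ℓ r w₁ w₂ (a, b) : ℝ) - m * ((k₁ a : ℝ) / M₁) * ((k₂ b : ℝ) / M₂)|) ⊆
            T₂.filter fun w₂ => ∃ b', δa ≤ |(countOn P w₂ b' : ℝ) / P.card - (k₂ b' : ℝ) / M₂| := by
          intro w₂ hw₂
          rw [mem_filter] at hw₂ ⊢
          refine ⟨hw₂.1, b, ?_⟩
          have hbad := hw₂.2
          rw [pairCount_eq_countOn] at hbad
          change ε * m ≤ |(countOn P w₂ b : ℝ) - m * ((k₁ a : ℝ) / M₁) * ((k₂ b : ℝ) / M₂)| at hbad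
          rw [hPcard]
          -- `|count - m_a p₂| ≥ (ε - δ) m`
          have h1 : (ε - δ) * m ≤ |(countOn P w₂ b : ℝ) - Ua.card * ((k₂ b : ℝ) / M₂)| := by
            have htri : |(countOn P w₂ b : ℝ) - m * ((k₁ a : ℝ) / M₁) * ((k₂ b : ℝ) / M₂)| ≤
                |(countOn P w₂ b : ℝ) - Ua.card * ((k₂ b : ℝ) / M₂)| + |(Ua.card : ℝ) - m * ((k₁ a : ℝ) / M₁)| * ((k₂ b : ℝ) / M₂) := by
              have e : (countOn P w₂ b : ℝ) - m * ((k₁ a : ℝ) / M₁) * ((k₂ b : ℝ) / M₂) =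
                  ((countOn P w₂ b : ℝ) - Ua.card * ((k₂ b : ℝ) / M₂)) + ((Ua.card : ℝ) - m * ((k₁ a : ℝ) / M₁)) * ((k₂ b : ℝ) / M₂) := by ring
              rw [e]
              refine (abs_add_le _ _).trans (add_le_add le_rfl ?_)
              rw [abs_mul, abs_of_nonneg (hp₂nn b)]
            have h2 : |(Ua.card : ℝ) - m * ((k₁ a : ℝ) / M₁)| * ((k₂ b : ℝ) / M₂) ≤ δ * m := by
              calc |(Ua.card : ℝ) - m * ((k₁ a : ℝ) / M₁)| * ((k₂ b : ℝ) / M₂) ≤ |(Ua.card : ℝ) - m * ((k₁ a : ℝ) / M₁)| * 1 :=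
                    mul_le_mul_of_nonneg_left (hp₂le b) (abs_nonneg _)
                _ ≤ δ * m := by rw [mul_one]; exact hma_typ.le
            linarith
          -- divide by `m_a`
          have e2 : (countOn P w₂ b : ℝ) - Ua.card * ((k₂ b : ℝ) / M₂) = Ua.card * ((countOn P w₂ b : ℝ) / Ua.card - (k₂ b : ℝ) / M₂) := by
            field_simp
          rw [e2, abs_mul, abs_of_pos hmaR'] at h1
          rw [hδa, hδdef] at *
          rw [show ε / 2 * ((m : ℝ) / Ua.card) = ((ε - ε / 2) * m) / Ua.card by ring]
          rw [div_le_iff₀ hmaR']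
          linarith
        have hconc := typeClassOn_restriction_concentration k₂ hk₂ P hδa_pos
        rw [hPcard] at hconc
        -- compare the exponents and polynomial factors
        have hexp : Real.exp (-(Ua.card * δa ^ 2 / 2)) ≤ Real.exp (-(m * ε ^ 2 / 8)) := by
          rw [Real.exp_le_exp, neg_le_neg_iff, hδa]
          have e : (Ua.card : ℝ) * (ε / 2 * ((m : ℝ) / Ua.card)) ^ 2 / 2 = (m * ε ^ 2 / 8) * (m / Ua.card) := by
            field_simp
            ring
          rw [e]
          have : (1 : ℝ) ≤ m / Ua.card := by rw [le_div_iff₀ hmaR', one_mul]; exact hmaR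
          nlinarith [show (0:ℝ) ≤ m * ε ^ 2 / 8 by positivity]
        have hpoly : ((Ua.card : ℝ) + 1) ^ Fintype.card A ≤ ((m : ℝ) + 1) ^ Fintype.card A :=
          pow_le_pow_left₀ (by positivity) (by linarith) _
        calc ((T₂.filter fun w₂ => ε * m ≤ |(pairCount ℓ r w₁ w₂ (a, b) : ℝ) - m * ((k₁ a : ℝ) / M₁) * ((k₂ b : ℝ) / M₂)|).card : ℝ)
            ≤ ((T₂.filter fun w₂ => ∃ b', δa ≤ |(countOn P w₂ b' : ℝ) / Ua.card - (k₂ b' : ℝ) / M₂|).card : ℝ) := by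
              rw [← hPcard]; exact_mod_cast card_le_card hsub
          _ ≤ ((Ua.card : ℝ) + 1) ^ Fintype.card A * ((M₂ : ℝ) + 1) ^ Fintype.card A * Real.exp (-(Ua.card * δa ^ 2 / 2)) * T₂.card := hconc
          _ ≤ ((m : ℝ) + 1) ^ Fintype.card A * ((M₂ : ℝ) + 1) ^ Fintype.card A * Real.exp (-(m * ε ^ 2 / 8)) * T₂.card := by
              gcongr
    calc ((T₂.filter fun w₂ => BadP (w₁, w₂)).card : ℝ)
        ≤ (((univ : Finset (A × A)).biUnion fun ab => T₂.filter fun w₂ =>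
            ε * m ≤ |(pairCount ℓ r w₁ w₂ ab : ℝ) - m * ((k₁ ab.1 : ℝ) / M₁) * ((k₂ ab.2 : ℝ) / M₂)|).card : ℝ) := by
          exact_mod_cast card_le_card hcover
      _ ≤ ∑ ab : A × A, ((T₂.filter fun w₂ =>
            ε * m ≤ |(pairCount ℓ r w₁ w₂ ab : ℝ) - m * ((k₁ ab.1 : ℝ) / M₁) * ((k₂ ab.2 : ℝ) / M₂)|).card : ℝ) := by
          exact_mod_cast card_biUnion_le
      _ ≤ ∑ _ab : A × A, ((m : ℝ) + 1) ^ Fintype.card A * ((M₂ : ℝ) + 1) ^ Fintype.card A * Real.exp (-(m * ε ^ 2 / 8)) * T₂.card :=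
          sum_le_sum fun ab _ => hper ab
      _ = (Fintype.card A : ℝ) ^ 2 * (((m : ℝ) + 1) ^ Fintype.card A * ((M₂ : ℝ) + 1) ^ Fintype.card A *
          Real.exp (-(m * ε ^ 2 / 8)) * T₂.card) := by
          rw [sum_const, nsmul_eq_mul, card_univ, Fintype.card_prod]; push_cast; ring
  -- assemble: split `Bad` by typicality of the first word
  have hsplit := Finset.card_filter_add_card_filter_not (s := Bad) (fun w => w.1 ∈ Far₁)
  have hA : ((Bad.filter fun w => w.1 ∈ Far₁).card : ℝ) ≤ Far₁.card * T₂.card := by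
    have hsub : (Bad.filter fun w => w.1 ∈ Far₁) ⊆ Far₁ ×ˢ T₂ := by
      intro w hw
      rw [mem_filter] at hw
      rw [hBad, mem_filter, mem_product] at hw
      exact mem_product.2 ⟨hw.2, hw.1.1.2⟩
    have := card_le_card hsub
    rw [card_product] at this
    exact_mod_cast this
  have hB : ((Bad.filter fun w => w.1 ∉ Far₁).card : ℝ) ≤ T₁.card * ((Fintype.card A : ℝ) ^ 2 *
      (((m : ℝ) + 1) ^ Fintype.card A * ((M₂ : ℝ) + 1) ^ Fintype.card A * Real.exp (-(m * ε ^ 2 / 8)) * T₂.card)) := by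
    rw [card_eq_sum_card_fiberwise (f := fun w : (C₁ → A) × (C₂ → A) => w.1) (s := Bad.filter fun w => w.1 ∉ Far₁) (t := T₁)
      (fun w hw => by
        rw [mem_coe, mem_filter, hBad, mem_filter, mem_product] at hw
        exact hw.1.1.1)]
    push_cast
    calc ∑ w₁ ∈ T₁, (((Bad.filter fun w => w.1 ∉ Far₁).filter fun w => w.1 = w₁).card : ℝ)
        ≤ ∑ w₁ ∈ T₁, (Fintype.card A : ℝ) ^ 2 * (((m : ℝ) + 1) ^ Fintype.card A * ((M₂ : ℝ) + 1) ^ Fintype.card A *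
            Real.exp (-(m * ε ^ 2 / 8)) * T₂.card) := by
          refine sum_le_sum fun w₁ hw₁ => ?_
          by_cases hfar : w₁ ∈ Far₁
          · have h0 : ((Bad.filter fun w => w.1 ∉ Far₁).filter fun w => w.1 = w₁) = ∅ :=
              filter_false_of_mem fun w hw => by
                rw [mem_filter] at hw
                rintro rfl; exact hw.2 hfar
            rw [h0, card_empty, Nat.cast_zero]; positivity
          · -- the fibre injects into the bad second words
            have hinj : (((Bad.filter fun w => w.1 ∉ Far₁).filter fun w => w.1 = w₁).card : ℝ) ≤
                ((T₂.filter fun w₂ => BadP (w₁, w₂)).card : ℝ) := by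
              have := card_le_card_of_injOn (fun w : (C₁ → A) × (C₂ → A) => w.2)
                (s := (Bad.filter fun w => w.1 ∉ Far₁).filter fun w => w.1 = w₁) (t := T₂.filter fun w₂ => BadP (w₁, w₂))
                (fun w hw => by
                  rw [mem_coe, mem_filter, mem_filter, hBad, mem_filter, mem_product] at hw
                  obtain ⟨⟨⟨⟨-, hw2⟩, hbad⟩, -⟩, rfl⟩ := hw
                  rw [mem_coe, mem_filter]
                  exact ⟨hw2, hbad⟩)
                (fun w hw w' hw' h => by
                  rw [mem_coe, mem_filter] at hw hw'
                  exact Prod.ext (hw.2.trans hw'.2.symm) h)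
              exact_mod_cast this
            exact hinj.trans (hfibre w₁ hw₁ hfar)
      _ = T₁.card * ((Fintype.card A : ℝ) ^ 2 * (((m : ℝ) + 1) ^ Fintype.card A * ((M₂ : ℝ) + 1) ^ Fintype.card A *
            Real.exp (-(m * ε ^ 2 / 8)) * T₂.card)) := by rw [sum_const, nsmul_eq_mul]
  have hexp₁ : Real.exp (-(m * δ ^ 2 / 2)) = Real.exp (-(m * ε ^ 2 / 8)) := by
    rw [hδdef]; ring_nf
  have htot : (Bad.card : ℝ) = ((Bad.filter fun w => w.1 ∈ Far₁).card : ℝ) + ((Bad.filter fun w => w.1 ∉ Far₁).card : ℝ) := by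
    rw [← Nat.cast_add, hsplit]
  rw [htot]
  have hT₂0 : (0 : ℝ) ≤ T₂.card := Nat.cast_nonneg _
  calc ((Bad.filter fun w => w.1 ∈ Far₁).card : ℝ) + ((Bad.filter fun w => w.1 ∉ Far₁).card : ℝ)
      ≤ Far₁.card * T₂.card + T₁.card * ((Fintype.card A : ℝ) ^ 2 * (((m : ℝ) + 1) ^ Fintype.card A *
          ((M₂ : ℝ) + 1) ^ Fintype.card A * Real.exp (-(m * ε ^ 2 / 8)) * T₂.card)) := add_le_add hA hB
    _ ≤ ((m : ℝ) + 1) ^ Fintype.card A * ((M₁ : ℝ) + 1) ^ Fintype.card A * Real.exp (-(m * ε ^ 2 / 8)) * T₁.card * T₂.card +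
        T₁.card * ((Fintype.card A : ℝ) ^ 2 * (((m : ℝ) + 1) ^ Fintype.card A *
          ((M₂ : ℝ) + 1) ^ Fintype.card A * Real.exp (-(m * ε ^ 2 / 8)) * T₂.card)) := by
        rw [← hexp₁]
        exact add_le_add (mul_le_mul_of_nonneg_right hFar₁_bound hT₂0) le_rfl
    _ = ((m : ℝ) + 1) ^ Fintype.card A * (((M₁ : ℝ) + 1) ^ Fintype.card A + (Fintype.card A : ℝ) ^ 2 * ((M₂ : ℝ) + 1) ^ Fintype.card A) *
        Real.exp (-(m * ε ^ 2 / 8)) * T₁.card * T₂.card := by ring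

end TwoWords

/-! ## Pair statistics within one random word (self-paired classes) -/

section OneWord

variable {A : Type*} [Fintype A] [DecidableEq A]
variable {C U : Type*} [Fintype C] [DecidableEq C] [Fintype U]

/-- Restriction to `P₁ᶜ` of a word of type `k` extending the pattern `v` on `P₁` has type `k − count(v)`. [folklore] -/
theorem restrict_compl_mem_typeClassOn {k : A → ℕ} {P₁ : Finset C} {v : ↥P₁ → A} {w : C → A}
    (hw : w ∈ typeClassOn C k) (hwv : ∀ q : ↥P₁, w q = v q) :
    (fun q : ↥(P₁ᶜ) => w q) ∈ typeClassOn ↥(P₁ᶜ) (fun a => k a - patternCount P₁ v a) := by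
  classical
  refine mem_typeClassOn.2 fun a => ?_
  have h1 : countOn P₁ w a = patternCount P₁ v a := countOn_eq_patternCount_of_restrict hwv a
  have h2 : countOn univ w a = countOn P₁ w a + countOn P₁ᶜ w a := by
    rw [countOn_apply, countOn_apply, countOn_apply, ← card_union_of_disjoint]
    · congr 1; ext c; simp only [mem_filter, mem_univ, true_and, mem_union, mem_compl]; tauto
    · exact disjoint_filter_filter disjoint_compl_right
  rw [countOn_univ_of_mem_typeClassOn hw, h1] at h2
  rw [← countOn_eq_card_subtype]
  omega

omit [Fintype A] [DecidableEq A] in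
/-- Restriction to `P₁ᶜ` is injective on the words extending a fixed pattern on `P₁`. [folklore] -/
theorem restrict_compl_injOn {P₁ : Finset C} {v : ↥P₁ → A} {w₁ w₂ : C → A}
    (h₁ : ∀ q : ↥P₁, w₁ q = v q) (h₂ : ∀ q : ↥P₁, w₂ q = v q)
    (h : (fun q : ↥(P₁ᶜ) => w₁ q) = fun q : ↥(P₁ᶜ) => w₂ q) : w₁ = w₂ := by
  funext c
  by_cases hc : c ∈ P₁
  · rw [h₁ ⟨c, hc⟩, h₂ ⟨c, hc⟩]
  · exact congrFun h ⟨c, mem_compl.2 hc⟩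

set_option maxHeartbeats 1000000 in
/-- **One pair, one pattern**: for a pattern `v` on `ℓ(U)` that is `ε/4`-typical, words of type `k`
extending `v` whose pair count at `(a,b)` deviates by `≥ ε m` restrict injectively to words on the
complement that are atypical on the `b`-counts of the `a`-probe positions; hence at most
`(m+1)^{|A|}(|C|+1)^{|A|} e^{−mε²/8} |T(ℓ(U)ᶜ, k − count v)|` of them. [cite: VassilevskaWilliamsXuXuZhou2024, §6.6; CoverThomas2006, Thm. 11.1.4] -/
theorem oneWord_pattern_pair_bound (k : A → ℕ) (hk : ∑ a, k a = Fintype.card C) (ℓ r : U ↪ C)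
    (hdisj : ∀ u u', ℓ u ≠ r u') (hU : 0 < Fintype.card U) {ε : ℝ} (hε : 0 < ε)
    (v : ↥(univ.map ℓ) → A) (hvk : ∀ a, patternCount (univ.map ℓ) v a ≤ k a)
    (htyp : ∀ a, |(patternCount (univ.map ℓ) v a : ℝ) / Fintype.card U - (k a : ℝ) / Fintype.card C| < ε / 4) (a b : A) :
    ((((typeClassOn C k).filter fun w => ∀ q : ↥(univ.map ℓ), w q = v q).filter fun w =>
        ε * Fintype.card U ≤ |(pairCount ℓ r w w (a, b) : ℝ) -
          Fintype.card U * ((k a : ℝ) / Fintype.card C) * ((k b : ℝ) / Fintype.card C)|).card : ℝ) ≤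
      ((Fintype.card U : ℝ) + 1) ^ Fintype.card A * ((Fintype.card C : ℝ) + 1) ^ Fintype.card A *
        Real.exp (-(Fintype.card U * ε ^ 2 / 8)) *
        (typeClassOn ↥((univ.map ℓ)ᶜ) (fun a' => k a' - patternCount (univ.map ℓ) v a')).card := by
  classical
  -- notation
  have hmR : (0 : ℝ) < Fintype.card U := by exact_mod_cast hU
  have hP₁card : (univ.map ℓ).card = Fintype.card U := by rw [card_map, card_univ]
  have hℓP₁ : ∀ u, ℓ u ∈ univ.map ℓ := fun u => mem_map_of_mem _ (mem_univ u)
  have hrP₁ : ∀ u, r u ∈ (univ.map ℓ)ᶜ := fun u => by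
    rw [mem_compl, mem_map]; rintro ⟨u', -, h⟩; exact hdisj u' u h
  have hM2m : 2 * Fintype.card U ≤ Fintype.card C := by
    have h := card_le_univ (univ.map ℓ ∪ univ.map r)
    rw [card_union_of_disjoint, card_map, card_map, card_univ] at h
    · omega
    · rw [disjoint_left]
      intro c hc hc'
      rw [mem_map] at hc hc'
      obtain ⟨u, -, rfl⟩ := hc
      obtain ⟨u', -, h⟩ := hc'
      exact hdisj u u' h.symm
  have hMpos : 0 < Fintype.card C := by omega
  have hMR : (0 : ℝ) < Fintype.card C := by exact_mod_cast hMpos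
  have hM'card : Fintype.card ↥((univ.map ℓ)ᶜ) = Fintype.card C - Fintype.card U := by
    rw [Fintype.card_coe, card_compl, hP₁card]
  have hmM' : Fintype.card U ≤ Fintype.card C - Fintype.card U := by omega
  have hM'R : (Fintype.card U : ℝ) ≤ ((Fintype.card C - Fintype.card U : ℕ) : ℝ) := by exact_mod_cast hmM'
  have hM'pos : (0 : ℝ) < ((Fintype.card C - Fintype.card U : ℕ) : ℝ) := lt_of_lt_of_le hmR hM'R
  have hMm : ((Fintype.card C - Fintype.card U : ℕ) : ℝ) = (Fintype.card C : ℝ) - Fintype.card U := by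
    push_cast [Nat.cast_sub (show Fintype.card U ≤ Fintype.card C by omega)]; ring
  have hple : (k b : ℝ) / Fintype.card C ≤ 1 := by
    rw [div_le_one hMR]
    have : k b ≤ Fintype.card C := by rw [← hk]; exact single_le_sum (fun _ _ => Nat.zero_le _) (mem_univ b)
    exact_mod_cast this
  have hpnn : (0 : ℝ) ≤ (k b : ℝ) / Fintype.card C := by positivity
  -- the conditioned type on the complement is `ε/4`-close to `k/|C|`
  set k' : A → ℕ := fun a' => k a' - patternCount (univ.map ℓ) v a' with hk'def
  have hk'sum : ∑ a', k' a' = Fintype.card ↥((univ.map ℓ)ᶜ) := by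
    rw [hM'card]
    show ∑ a', (k a' - patternCount (univ.map ℓ) v a') = Fintype.card C - Fintype.card U
    rw [sum_tsub_distrib _ (fun a' _ => hvk a'), hk]
    have : ∑ a', patternCount (univ.map ℓ) v a' = Fintype.card U := by
      have h := card_eq_sum_card_fiberwise (f := v) (s := (univ : Finset ↥(univ.map ℓ))) (t := univ) fun _ _ => mem_univ _
      rw [card_univ, Fintype.card_coe, hP₁card] at h
      exact h.symm
    rw [this]
  have hk'close : |(k' b : ℝ) / ((Fintype.card C - Fintype.card U : ℕ) : ℝ) - (k b : ℝ) / Fintype.card C| ≤ ε / 4 := by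
    have hkb : (k' b : ℝ) = k b - patternCount (univ.map ℓ) v b := by
      rw [hk'def]; push_cast [Nat.cast_sub (hvk b)]; ring
    have hne : (Fintype.card C : ℝ) - Fintype.card U ≠ 0 := by rw [← hMm]; exact hM'pos.ne'
    have e : (k' b : ℝ) / ((Fintype.card C - Fintype.card U : ℕ) : ℝ) - (k b : ℝ) / Fintype.card C =
        ((Fintype.card U : ℝ) * ((k b : ℝ) / Fintype.card C) - patternCount (univ.map ℓ) v b) /
          ((Fintype.card C - Fintype.card U : ℕ) : ℝ) := by
      rw [hkb, hMm, div_sub_div _ _ hne hMR.ne', div_eq_div_iff (mul_ne_zero hne hMR.ne') hne]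
      field_simp
      ring
    rw [e, abs_div, abs_of_pos hM'pos, div_le_iff₀ hM'pos]
    have h1 : |(Fintype.card U : ℝ) * ((k b : ℝ) / Fintype.card C) - patternCount (univ.map ℓ) v b| < ε / 4 * Fintype.card U := by
      have h := htyp b
      have e2 : (Fintype.card U : ℝ) * ((k b : ℝ) / Fintype.card C) - patternCount (univ.map ℓ) v b =
          -(Fintype.card U * ((patternCount (univ.map ℓ) v b : ℝ) / Fintype.card U - (k b : ℝ) / Fintype.card C)) := by
        field_simp; ring
      rw [e2, abs_neg, abs_mul, abs_of_pos hmR]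
      calc (Fintype.card U : ℝ) * |(patternCount (univ.map ℓ) v b : ℝ) / Fintype.card U - (k b : ℝ) / Fintype.card C|
          < Fintype.card U * (ε / 4) := mul_lt_mul_of_pos_left h hmR
        _ = ε / 4 * Fintype.card U := mul_comm _ _
    calc |(Fintype.card U : ℝ) * ((k b : ℝ) / Fintype.card C) - patternCount (univ.map ℓ) v b| ≤ ε / 4 * Fintype.card U := h1.le
      _ ≤ ε / 4 * ((Fintype.card C - Fintype.card U : ℕ) : ℝ) := mul_le_mul_of_nonneg_left hM'R (by positivity)
  -- the `a`-probes (determined by the pattern) and their `r`-positions inside the complement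
  set Ua : Finset U := univ.filter fun u => v ⟨ℓ u, hℓP₁ u⟩ = a with hUa
  have hma_le : Ua.card ≤ Fintype.card U := (card_filter_le _ _).trans_eq card_univ
  have hmaR : (Ua.card : ℝ) ≤ Fintype.card U := by exact_mod_cast hma_le
  have hUa_count : (Ua.card : ℝ) = patternCount (univ.map ℓ) v a := by
    norm_cast
    rw [hUa]
    refine card_bij (fun u _ => ⟨ℓ u, hℓP₁ u⟩) (fun u hu => by simpa using hu) (fun u₁ _ u₂ _ h => ℓ.injective (congrArg Subtype.val h))
      (fun q hq => ?_)
    obtain ⟨u, -, hu⟩ := mem_map.1 q.2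
    refine ⟨u, ?_, Subtype.ext hu⟩
    have : (⟨ℓ u, hℓP₁ u⟩ : ↥(univ.map ℓ)) = q := Subtype.ext hu
    rw [mem_filter] at hq ⊢
    exact ⟨mem_univ _, by rw [this]; exact hq.2⟩
  have hma_typ : |(Ua.card : ℝ) - Fintype.card U * ((k a : ℝ) / Fintype.card C)| < ε / 4 * Fintype.card U := by
    have h := htyp a
    rw [← hUa_count] at h
    have e : (Ua.card : ℝ) - Fintype.card U * ((k a : ℝ) / Fintype.card C) =
        Fintype.card U * ((Ua.card : ℝ) / Fintype.card U - (k a : ℝ) / Fintype.card C) := by field_simp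
    rw [e, abs_mul, abs_of_pos hmR]
    calc (Fintype.card U : ℝ) * |(Ua.card : ℝ) / Fintype.card U - (k a : ℝ) / Fintype.card C| < Fintype.card U * (ε / 4) :=
        mul_lt_mul_of_pos_left h hmR
      _ = ε / 4 * Fintype.card U := mul_comm _ _
  let rEmb : U ↪ ↥((univ.map ℓ)ᶜ) := ⟨fun u => ⟨r u, hrP₁ u⟩, fun u u' h => r.injective (congrArg Subtype.val h)⟩
  set Q : Finset ↥((univ.map ℓ)ᶜ) := Ua.map rEmb with hQ
  have hQcard : Q.card = Ua.card := card_map _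
  have hcount : ∀ w : C → A, (∀ q : ↥(univ.map ℓ), w q = v q) →
      pairCount ℓ r w w (a, b) = countOn Q (fun q : ↥((univ.map ℓ)ᶜ) => w q) b := by
    intro w hwv
    rw [countOn_apply, hQ, filter_map, card_map, hUa, filter_filter, pairCount]
    congr 1
    ext u
    simp only [mem_filter, mem_univ, true_and]
    rw [hwv ⟨ℓ u, hℓP₁ u⟩]
    rfl
  -- the set to bound
  set S := ((typeClassOn C k).filter fun w => ∀ q : ↥(univ.map ℓ), w q = v q).filter fun w =>
      ε * Fintype.card U ≤ |(pairCount ℓ r w w (a, b) : ℝ) -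
        Fintype.card U * ((k a : ℝ) / Fintype.card C) * ((k b : ℝ) / Fintype.card C)| with hS
  rcases Nat.eq_zero_or_pos Ua.card with hma0 | hma_pos
  · -- no `a`-probes: the set is empty
    have hS0 : S = ∅ := by
      refine filter_false_of_mem fun w hw => ?_
      have hwv : ∀ q : ↥(univ.map ℓ), w q = v q := (mem_filter.1 hw).2
      rw [not_le]
      have hpc : pairCount ℓ r w w (a, b) = 0 := by
        rw [hcount w hwv, countOn_apply]
        have : Q = ∅ := card_eq_zero.1 (by rw [hQcard, hma0])
        rw [this, filter_empty, card_empty]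
      rw [hpc, Nat.cast_zero, zero_sub, abs_neg]
      rw [hma0, Nat.cast_zero, zero_sub, abs_neg] at hma_typ
      calc |(Fintype.card U : ℝ) * ((k a : ℝ) / Fintype.card C) * ((k b : ℝ) / Fintype.card C)|
          = |(Fintype.card U : ℝ) * ((k a : ℝ) / Fintype.card C)| * ((k b : ℝ) / Fintype.card C) := by
            rw [abs_mul, abs_of_nonneg hpnn]
        _ ≤ |(Fintype.card U : ℝ) * ((k a : ℝ) / Fintype.card C)| * 1 := mul_le_mul_of_nonneg_left hple (abs_nonneg _)
        _ < ε / 4 * Fintype.card U := by rw [mul_one]; exact hma_typ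
        _ ≤ ε * Fintype.card U := by nlinarith
    rw [hS0, card_empty, Nat.cast_zero]; positivity
  -- `m_a ≥ 1`
  have hmaR' : (0 : ℝ) < Ua.card := by exact_mod_cast hma_pos
  set δa : ℝ := (ε / 2) * (Fintype.card U / Ua.card) with hδa
  have hδa_pos : 0 < δa := by rw [hδa]; positivity
  set Far' := (typeClassOn ↥((univ.map ℓ)ᶜ) k').filter fun w' =>
      ∃ b', δa ≤ |(countOn Q w' b' : ℝ) / Q.card - (k' b' : ℝ) / Fintype.card ↥((univ.map ℓ)ᶜ)| with hFar'
  have hinj : (S.card : ℝ) ≤ Far'.card := by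
    have h := card_le_card_of_injOn (fun w : C → A => fun q : ↥((univ.map ℓ)ᶜ) => w q) (s := S) (t := Far')
      (fun w hw => ?_) (fun w₁ hw₁ w₂ hw₂ h => ?_)
    · exact_mod_cast h
    · rw [mem_coe, hS, mem_filter, mem_filter] at hw
      obtain ⟨⟨hwT, hwv⟩, hbad⟩ := hw
      rw [mem_coe, hFar', mem_filter]
      refine ⟨restrict_compl_mem_typeClassOn hwT hwv, b, ?_⟩
      rw [hQcard, hM'card]
      rw [hcount w hwv] at hbad
      -- `|count - m_a k(b)/|C|| ≥ (3ε/4) m`, then `|count - m_a k'(b)/M'| ≥ (ε/2) m`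
      have h1 : (ε - ε / 4) * Fintype.card U ≤
          |(countOn Q (fun q : ↥((univ.map ℓ)ᶜ) => w q) b : ℝ) - Ua.card * ((k b : ℝ) / Fintype.card C)| := by
        have e : (countOn Q (fun q : ↥((univ.map ℓ)ᶜ) => w q) b : ℝ) -
            Fintype.card U * ((k a : ℝ) / Fintype.card C) * ((k b : ℝ) / Fintype.card C) =
            ((countOn Q (fun q : ↥((univ.map ℓ)ᶜ) => w q) b : ℝ) - Ua.card * ((k b : ℝ) / Fintype.card C)) +
              ((Ua.card : ℝ) - Fintype.card U * ((k a : ℝ) / Fintype.card C)) * ((k b : ℝ) / Fintype.card C) := by ring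
        rw [e] at hbad
        have htri := (abs_add_le _ _).trans' hbad
        have h2 : |((Ua.card : ℝ) - Fintype.card U * ((k a : ℝ) / Fintype.card C)) * ((k b : ℝ) / Fintype.card C)| ≤
            ε / 4 * Fintype.card U := by
          rw [abs_mul, abs_of_nonneg hpnn]
          calc |(Ua.card : ℝ) - Fintype.card U * ((k a : ℝ) / Fintype.card C)| * ((k b : ℝ) / Fintype.card C)
              ≤ |(Ua.card : ℝ) - Fintype.card U * ((k a : ℝ) / Fintype.card C)| * 1 := mul_le_mul_of_nonneg_left hple (abs_nonneg _)
            _ ≤ ε / 4 * Fintype.card U := by rw [mul_one]; exact hma_typ.le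
        linarith
      have h3 : (ε / 2) * Fintype.card U ≤
          |(countOn Q (fun q : ↥((univ.map ℓ)ᶜ) => w q) b : ℝ) - Ua.card * ((k' b : ℝ) / ((Fintype.card C - Fintype.card U : ℕ) : ℝ))| := by
        have e : (countOn Q (fun q : ↥((univ.map ℓ)ᶜ) => w q) b : ℝ) - Ua.card * ((k b : ℝ) / Fintype.card C) =
            ((countOn Q (fun q : ↥((univ.map ℓ)ᶜ) => w q) b : ℝ) - Ua.card * ((k' b : ℝ) / ((Fintype.card C - Fintype.card U : ℕ) : ℝ))) +
              Ua.card * ((k' b : ℝ) / ((Fintype.card C - Fintype.card U : ℕ) : ℝ) - (k b : ℝ) / Fintype.card C) := by ring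
        rw [e] at h1
        have htri := (abs_add_le _ _).trans' h1
        have h4 : |(Ua.card : ℝ) * ((k' b : ℝ) / ((Fintype.card C - Fintype.card U : ℕ) : ℝ) - (k b : ℝ) / Fintype.card C)| ≤
            ε / 4 * Fintype.card U := by
          rw [abs_mul, abs_of_nonneg (Nat.cast_nonneg _)]
          calc (Ua.card : ℝ) * |(k' b : ℝ) / ((Fintype.card C - Fintype.card U : ℕ) : ℝ) - (k b : ℝ) / Fintype.card C|
              ≤ Fintype.card U * (ε / 4) := mul_le_mul hmaR hk'close (abs_nonneg _) hmR.le
            _ = ε / 4 * Fintype.card U := mul_comm _ _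
        linarith
      have e2 : (countOn Q (fun q : ↥((univ.map ℓ)ᶜ) => w q) b : ℝ) - Ua.card * ((k' b : ℝ) / ((Fintype.card C - Fintype.card U : ℕ) : ℝ)) =
          Ua.card * ((countOn Q (fun q : ↥((univ.map ℓ)ᶜ) => w q) b : ℝ) / Ua.card -
            (k' b : ℝ) / ((Fintype.card C - Fintype.card U : ℕ) : ℝ)) := by field_simp
      rw [e2, abs_mul, abs_of_pos hmaR'] at h3
      rw [hδa, show ε / 2 * ((Fintype.card U : ℝ) / Ua.card) = (ε / 2 * Fintype.card U) / Ua.card by ring, div_le_iff₀ hmaR']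
      linarith
    · rw [mem_coe, hS, mem_filter, mem_filter] at hw₁ hw₂
      exact restrict_compl_injOn hw₁.1.2 hw₂.1.2 h
  have hconc := typeClassOn_restriction_concentration k' hk'sum Q hδa_pos
  have hexp : Real.exp (-(Ua.card * δa ^ 2 / 2)) ≤ Real.exp (-(Fintype.card U * ε ^ 2 / 8)) := by
    rw [Real.exp_le_exp, neg_le_neg_iff, hδa]
    have e : (Ua.card : ℝ) * (ε / 2 * ((Fintype.card U : ℝ) / Ua.card)) ^ 2 / 2 =
        (Fintype.card U * ε ^ 2 / 8) * (Fintype.card U / Ua.card) := by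
      field_simp; ring
    rw [e]
    have : (1 : ℝ) ≤ Fintype.card U / Ua.card := by rw [le_div_iff₀ hmaR', one_mul]; exact hmaR
    nlinarith [show (0:ℝ) ≤ Fintype.card U * ε ^ 2 / 8 by positivity]
  have hpoly : ((Ua.card : ℝ) + 1) ^ Fintype.card A ≤ ((Fintype.card U : ℝ) + 1) ^ Fintype.card A :=
    pow_le_pow_left₀ (by positivity) (by linarith) _
  have hpolyM : ((Fintype.card ↥((univ.map ℓ)ᶜ) : ℝ) + 1) ^ Fintype.card A ≤ ((Fintype.card C : ℝ) + 1) ^ Fintype.card A := by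
    refine pow_le_pow_left₀ (by positivity) ?_ _
    rw [hM'card]
    have : ((Fintype.card C - Fintype.card U : ℕ) : ℝ) ≤ Fintype.card C := by exact_mod_cast Nat.sub_le _ _
    linarith
  have hT'0 : (0 : ℝ) ≤ (typeClassOn ↥((univ.map ℓ)ᶜ) k').card := Nat.cast_nonneg _
  calc (S.card : ℝ) ≤ Far'.card := hinj
    _ ≤ ((Q.card : ℝ) + 1) ^ Fintype.card A * ((Fintype.card ↥((univ.map ℓ)ᶜ) : ℝ) + 1) ^ Fintype.card A *
          Real.exp (-(Q.card * δa ^ 2 / 2)) * (typeClassOn ↥((univ.map ℓ)ᶜ) k').card := hconc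
    _ ≤ ((Fintype.card U : ℝ) + 1) ^ Fintype.card A * ((Fintype.card C : ℝ) + 1) ^ Fintype.card A *
          Real.exp (-(Fintype.card U * ε ^ 2 / 8)) * (typeClassOn ↥((univ.map ℓ)ᶜ) k').card := by
        rw [hQcard]
        refine mul_le_mul_of_nonneg_right ?_ hT'0
        exact mul_le_mul (mul_le_mul hpoly hpolyM (by positivity) (by positivity)) hexp (Real.exp_pos _).le (by positivity)

set_option maxHeartbeats 1000000 in
/-- **Concentration of pair statistics within ONE uniformly random word of a type class** (the
self-paired classes `(i',j',k') = (i_t − i', j_t − j', k_t − k')` of §6.6): for a type `k` on `C`,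
injective probes `ℓ, r : U ↪ C` with disjoint images (`m = |U| ≥ 1`) and `ε > 0`, the number of words
`w ∈ T(C,k)` with some pair count `#{u | w(ℓu) = a, w(ru) = b}` deviating from `m (k(a)/|C|)(k(b)/|C|)`
by `≥ ε m` is at most `(1 + |A|²) (m+1)^{|A|} (|C|+1)^{|A|} e^{−m ε²/32} |T(C,k)|`
(typicality on `ℓ(U)`, `typeClassOn_restriction_concentration`; conditioning on the pattern on `ℓ(U)`
leaves a uniformly random word on the complement, `card_typeClassOn_filter_restrict_eq`, of a type
within `ε/4` of `k/|C|` since `|C| ≥ 2m`; then `oneWord_pattern_pair_bound`).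
[cite: VassilevskaWilliamsXuXuZhou2024, §6.6 (first type of holes, concentration); CoverThomas2006, Thm. 11.1.4] -/
theorem oneWord_pairCount_concentration (k : A → ℕ) (hk : ∑ a, k a = Fintype.card C) (ℓ r : U ↪ C)
    (hdisj : ∀ u u', ℓ u ≠ r u') (hU : 0 < Fintype.card U) {ε : ℝ} (hε : 0 < ε) :
    (((typeClassOn C k).filter fun w => ∃ ab : A × A,
        ε * Fintype.card U ≤ |(pairCount ℓ r w w ab : ℝ) -
          Fintype.card U * ((k ab.1 : ℝ) / Fintype.card C) * ((k ab.2 : ℝ) / Fintype.card C)|).card : ℝ) ≤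
      (1 + (Fintype.card A : ℝ) ^ 2) * ((Fintype.card U : ℝ) + 1) ^ Fintype.card A * ((Fintype.card C : ℝ) + 1) ^ Fintype.card A *
        Real.exp (-(Fintype.card U * ε ^ 2 / 32)) * (typeClassOn C k).card := by
  classical
  have hmR : (0 : ℝ) < Fintype.card U := by exact_mod_cast hU
  have hP₁card : (univ.map ℓ).card = Fintype.card U := by rw [card_map, card_univ]
  -- abbreviations
  set T := typeClassOn C k with hT
  set BadP : (C → A) → Prop := fun w => ∃ ab : A × A,
      ε * Fintype.card U ≤ |(pairCount ℓ r w w ab : ℝ) -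
        Fintype.card U * ((k ab.1 : ℝ) / Fintype.card C) * ((k ab.2 : ℝ) / Fintype.card C)| with hBadP
  set Bad := T.filter BadP with hBad
  set Far := T.filter fun w => ∃ a, ε / 4 ≤ |(countOn (univ.map ℓ) w a : ℝ) / Fintype.card U - (k a : ℝ) / Fintype.card C| with hFar
  have hFar_bound : (Far.card : ℝ) ≤ ((Fintype.card U : ℝ) + 1) ^ Fintype.card A * ((Fintype.card C : ℝ) + 1) ^ Fintype.card A *
      Real.exp (-(Fintype.card U * (ε / 4) ^ 2 / 2)) * T.card := by
    have h := typeClassOn_restriction_concentration k hk (univ.map ℓ) (by positivity : (0:ℝ) < ε / 4)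
    rw [hP₁card] at h
    exact h
  have hexp₁ : Real.exp (-(Fintype.card U * (ε / 4) ^ 2 / 2)) = Real.exp (-(Fintype.card U * ε ^ 2 / 32)) := by ring_nf
  rw [hexp₁] at hFar_bound
  set B : ℝ := (Fintype.card A : ℝ) ^ 2 * (((Fintype.card U : ℝ) + 1) ^ Fintype.card A * ((Fintype.card C : ℝ) + 1) ^ Fintype.card A *
      Real.exp (-(Fintype.card U * ε ^ 2 / 8))) with hBdef
  have hB0 : 0 ≤ B := by rw [hBdef]; positivity
  -- fibrewise over the pattern on `ℓ(U)`
  have hfibre : ∀ v : ↥(univ.map ℓ) → A,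
      ((((Bad.filter fun w => w ∉ Far)).filter fun w => (fun q : ↥(univ.map ℓ) => w q) = v).card : ℝ) ≤
        B * ((T.filter fun w => ∀ q : ↥(univ.map ℓ), w q = v q).card : ℝ) := by
    intro v
    set Sv := (Bad.filter fun w => w ∉ Far).filter fun w => (fun q : ↥(univ.map ℓ) => w q) = v with hSv
    rcases Sv.eq_empty_or_nonempty with h0 | ⟨w₀, hw₀⟩
    · rw [h0, card_empty, Nat.cast_zero]; positivity
    rw [hSv, mem_filter, mem_filter, hBad, mem_filter] at hw₀
    obtain ⟨⟨⟨hw₀T, -⟩, hw₀good⟩, hw₀v⟩ := hw₀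
    have hw₀v' : ∀ q : ↥(univ.map ℓ), w₀ q = v q := fun q => congrFun hw₀v q
    have hcntv : ∀ a, countOn (univ.map ℓ) w₀ a = patternCount (univ.map ℓ) v a :=
      fun a => countOn_eq_patternCount_of_restrict hw₀v' a
    have htyp : ∀ a, |(patternCount (univ.map ℓ) v a : ℝ) / Fintype.card U - (k a : ℝ) / Fintype.card C| < ε / 4 := by
      intro a
      by_contra hge
      rw [not_lt] at hge
      exact hw₀good (mem_filter.2 ⟨hw₀T, a, by rw [hcntv a]; exact hge⟩)
    have hvk : ∀ a, patternCount (univ.map ℓ) v a ≤ k a := fun a => by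
      rw [← hcntv a, ← countOn_univ_of_mem_typeClassOn hw₀T a]; exact countOn_le_countOn_univ _ w₀ a
    -- cover `Sv` by the per-pair sets of extensions of `v`
    have hcover : Sv ⊆ (univ : Finset (A × A)).biUnion fun ab =>
        ((T.filter fun w => ∀ q : ↥(univ.map ℓ), w q = v q).filter fun w =>
          ε * Fintype.card U ≤ |(pairCount ℓ r w w (ab.1, ab.2) : ℝ) -
            Fintype.card U * ((k ab.1 : ℝ) / Fintype.card C) * ((k ab.2 : ℝ) / Fintype.card C)|) := by
      intro w hw
      rw [hSv, mem_filter, mem_filter, hBad, mem_filter] at hw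
      obtain ⟨⟨⟨hwT, ab, hab⟩, -⟩, hwv⟩ := hw
      refine mem_biUnion.2 ⟨ab, mem_univ _, mem_filter.2 ⟨mem_filter.2 ⟨hwT, fun q => congrFun hwv q⟩, ?_⟩⟩
      exact hab
    have hext : ((typeClassOn ↥((univ.map ℓ)ᶜ) (fun a' => k a' - patternCount (univ.map ℓ) v a')).card : ℝ) =
        ((T.filter fun w => ∀ q : ↥(univ.map ℓ), w q = v q).card : ℝ) := by
      rw [hT, card_typeClassOn_filter_restrict_eq k (univ.map ℓ) v hvk]
    calc (Sv.card : ℝ) ≤ (((univ : Finset (A × A)).biUnion fun ab =>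
          ((T.filter fun w => ∀ q : ↥(univ.map ℓ), w q = v q).filter fun w =>
            ε * Fintype.card U ≤ |(pairCount ℓ r w w (ab.1, ab.2) : ℝ) -
              Fintype.card U * ((k ab.1 : ℝ) / Fintype.card C) * ((k ab.2 : ℝ) / Fintype.card C)|)).card : ℝ) := by
          exact_mod_cast card_le_card hcover
      _ ≤ ∑ ab : A × A, (((T.filter fun w => ∀ q : ↥(univ.map ℓ), w q = v q).filter fun w =>
            ε * Fintype.card U ≤ |(pairCount ℓ r w w (ab.1, ab.2) : ℝ) -
              Fintype.card U * ((k ab.1 : ℝ) / Fintype.card C) * ((k ab.2 : ℝ) / Fintype.card C)|).card : ℝ) := by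
          exact_mod_cast card_biUnion_le
      _ ≤ ∑ _ab : A × A, ((Fintype.card U : ℝ) + 1) ^ Fintype.card A * ((Fintype.card C : ℝ) + 1) ^ Fintype.card A *
            Real.exp (-(Fintype.card U * ε ^ 2 / 8)) *
            (typeClassOn ↥((univ.map ℓ)ᶜ) (fun a' => k a' - patternCount (univ.map ℓ) v a')).card :=
          sum_le_sum fun ab _ => by
            rw [hT]; exact oneWord_pattern_pair_bound k hk ℓ r hdisj hU hε v hvk htyp ab.1 ab.2
      _ = B * ((T.filter fun w => ∀ q : ↥(univ.map ℓ), w q = v q).card : ℝ) := by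
          rw [sum_const, nsmul_eq_mul, card_univ, Fintype.card_prod, hext, hBdef]; push_cast; ring
  -- assemble
  have hsplit := Finset.card_filter_add_card_filter_not (s := Bad) (fun w => w ∈ Far)
  have hA : ((Bad.filter fun w => w ∈ Far).card : ℝ) ≤ Far.card := by
    exact_mod_cast card_le_card fun w hw => (mem_filter.1 hw).2
  have hBsum : ((Bad.filter fun w => w ∉ Far).card : ℝ) ≤ B * T.card := by
    rw [card_eq_sum_card_fiberwise (f := fun (w : C → A) (q : ↥(univ.map ℓ)) => w q) (s := Bad.filter fun w => w ∉ Far) (t := univ)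
      fun _ _ => mem_univ _]
    push_cast
    calc ∑ v : ↥(univ.map ℓ) → A, (((Bad.filter fun w => w ∉ Far).filter fun w => (fun q : ↥(univ.map ℓ) => w q) = v).card : ℝ)
        ≤ ∑ v : ↥(univ.map ℓ) → A, B * ((T.filter fun w => ∀ q : ↥(univ.map ℓ), w q = v q).card : ℝ) := sum_le_sum fun v _ => hfibre v
      _ = B * ∑ v : ↥(univ.map ℓ) → A, ((T.filter fun w => ∀ q : ↥(univ.map ℓ), w q = v q).card : ℝ) := by rw [mul_sum]
      _ = B * T.card := by
          congr 1
          rw [hT, card_typeClassOn_eq_sum_restrict k (univ.map ℓ)]; push_cast; rfl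
  have htot : (Bad.card : ℝ) = ((Bad.filter fun w => w ∈ Far).card : ℝ) + ((Bad.filter fun w => w ∉ Far).card : ℝ) := by
    rw [← Nat.cast_add, hsplit]
  rw [htot]
  have hexp₂ : Real.exp (-(Fintype.card U * ε ^ 2 / 8)) ≤ Real.exp (-(Fintype.card U * ε ^ 2 / 32)) := by
    rw [Real.exp_le_exp]
    have : (0 : ℝ) ≤ Fintype.card U * ε ^ 2 := by positivity
    linarith
  have hT0 : (0 : ℝ) ≤ T.card := Nat.cast_nonneg _
  have hBle : B ≤ (Fintype.card A : ℝ) ^ 2 * (((Fintype.card U : ℝ) + 1) ^ Fintype.card A * ((Fintype.card C : ℝ) + 1) ^ Fintype.card A *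
      Real.exp (-(Fintype.card U * ε ^ 2 / 32))) := by
    rw [hBdef]
    refine mul_le_mul_of_nonneg_left ?_ (by positivity)
    exact mul_le_mul_of_nonneg_left hexp₂ (by positivity)
  calc ((Bad.filter fun w => w ∈ Far).card : ℝ) + ((Bad.filter fun w => w ∉ Far).card : ℝ)
      ≤ Far.card + B * T.card := add_le_add hA hBsum
    _ ≤ ((Fintype.card U : ℝ) + 1) ^ Fintype.card A * ((Fintype.card C : ℝ) + 1) ^ Fintype.card A *
          Real.exp (-(Fintype.card U * ε ^ 2 / 32)) * T.card +
        (Fintype.card A : ℝ) ^ 2 * (((Fintype.card U : ℝ) + 1) ^ Fintype.card A * ((Fintype.card C : ℝ) + 1) ^ Fintype.card A *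
          Real.exp (-(Fintype.card U * ε ^ 2 / 32))) * T.card :=
        add_le_add hFar_bound (mul_le_mul_of_nonneg_right hBle hT0)
    _ = (1 + (Fintype.card A : ℝ) ^ 2) * ((Fintype.card U : ℝ) + 1) ^ Fintype.card A * ((Fintype.card C : ℝ) + 1) ^ Fintype.card A *
        Real.exp (-(Fintype.card U * ε ^ 2 / 32)) * T.card := by ring

end OneWord



end Literature.Computability.AlgebraicComplexity
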